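import Literature.Computability.QuantumComplexity.RazTalMaskedBlocks
import Literature.Computability.QuantumComplexity.RazTalMachine
import HarnessLib

/-!
# The Raz–Tal `BQP^O` machine on an XOR-masked window, II: `m` blocks, the threshold, the family

Sequel of `RazTalMaskedBlocks.lean` and variant of `RazTalMachine.lean`: the `m = rtBlocks n`
masked blocks (two oracle queries each, `blockOpsM`) are placed on the same global layout as the
original machine (pre-processing `preOps`, token count and read-out `postOps`, all reused), giving
the circuit `bigCircM n` with

* **`acceptProb_bigCircM : acceptProb = q1Accept n (mWindow O n)`** — the acceptance probability of
  Raz–Tal's `Q₁` on the *masked* level-`n` window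
  `mWindow O n i k = [rtAddr n i k ++ [0] ∈ O] ⊕ [rtAddr n i k ++ [1] ∈ O]`;
* the family `rtFamilyM n₀ tbl` (hard-wired below `n₀`, reusing `smallCirc`) and
  **`maskedMachine_of_isUniform`**: from the uniformity of the family (sequel
  `RazTalMaskedUniform.lean`), the quantum side of the algebraic oracle separation
  `BQP^A ⊄ BPP^Ã` (Aaronson–Wigderson Thm. 5.11 (v)).

## References

* R. Raz, A. Tal, *Oracle separation of BQP and PH*, J. ACM 69 (2022), App. A, Claim 8.1, §6
  [RazTalJACM2022].
* S. Aaronson, A. Wigderson, *Algebrization: a new barrier in complexity theory*, STOC 2008 (full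
  version), Thm. 5.11 (v) [AaronsonWigderson2008].
* M. A. Nielsen, I. L. Chuang, *Quantum Computation and Quantum Information*, CUP 2010, §2.1.7
  eq. (2.45), §3.2.5 [NielsenChuang2010].
-/

noncomputable section

namespace Literature.Computability.QuantumComplexity

open _root_.Computability Complexity Cryptography Matrix Finset RevSim

/-- **The masked window of an oracle language at level `n`**: bit `(i, k)` is
`[rtAddr n i k ++ [0] ∈ O] ⊕ [rtAddr n i k ++ [1] ∈ O]` (what the two phase queries of a masked
block accumulate). [cite: AaronsonWigderson2008, Thm. 5.11 (v)] -/
def mWindow (A : Language Bool) (n : ℕ) : Window n :=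
  fun i k => xor (A.boolIndicator (rtAddr n i k ++ [false])) (A.boolIndicator (rtAddr n i k ++ [true]))

namespace RazTalMachine

/-! ### The program -/

section GProgram

variable (n : ℕ)

/-- **The masked blocks**: masked block `i` shifted to its wires. [cite: RazTalJACM2022, App. A] -/
def blocksOpsM : List (RtOp ℕ) :=
  (List.range (rtBlocks n)).flatMap fun i => (blockOpsM n (rtL n) i).map (RtOp.map (· + blkBase n i))

/-- **The whole masked program at input length `n`.** [cite: RazTalJACM2022, App. A] -/
def allOpsM : List (RtOp ℕ) := (preOps n).map RtOp.cl ++ (blocksOpsM n ++ (postOps n).map RtOp.cl)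

variable {n}

/-- The masked blocks are well formed. [folklore] -/
theorem blocksOpsM_wf : ∀ op ∈ blocksOpsM n, op.WF := by
  intro op hop
  simp only [blocksOpsM, List.mem_flatMap, List.mem_range, List.mem_map] at hop
  obtain ⟨i, -, op, hop, rfl⟩ := hop
  exact (blockOpsM_wf i op hop).map_add _

/-- The wires of the masked blocks. [folklore] -/
theorem blocksOpsM_lt : ∀ op ∈ blocksOpsM n, ∀ w ∈ op.wires, w < rtW n := by
  intro op hop w hw
  simp only [blocksOpsM, List.mem_flatMap, List.mem_range, List.mem_map] at hop
  obtain ⟨i, hi, op', hop', rfl⟩ := hop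
  rw [RtOp.wires_map] at hw
  obtain ⟨w', hw', rfl⟩ := List.mem_map.1 hw
  rw [add_comm]
  exact blkBase_add_lt hi (blockOpsM_lt hi.le op' hop' w' hw')

/-- The whole masked program is well formed. [folklore] -/
theorem allOpsM_wf : ∀ op ∈ allOpsM n, op.WF := by
  intro op hop
  simp only [allOpsM, List.mem_append, List.mem_map] at hop
  rcases hop with ⟨op, hop, rfl⟩ | hop | ⟨op, hop, rfl⟩
  · exact preOps_wf op hop
  · exact blocksOpsM_wf op hop
  · exact postOps_wf op hop

/-- The wires of the whole masked program are below `rtW`. [folklore] -/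
theorem allOpsM_lt : ∀ op ∈ allOpsM n, ∀ w ∈ op.wires, w < rtW n := by
  intro op hop
  simp only [allOpsM, List.mem_append, List.mem_map] at hop
  rcases hop with ⟨op, hop, rfl⟩ | hop | ⟨op, hop, rfl⟩
  · exact preOps_lt op hop
  · exact blocksOpsM_lt op hop
  · exact postOps_lt op hop

variable (n)

/-- **The circuit of the masked Raz–Tal machine at input length `n`.** [cite: RazTalJACM2022, App. A] -/
def bigCircM : QCircuit cliffordT (rtW n) :=
  ⟨RtOp.compileList ((allOpsM n).map (RtOp.map (foW n))) (wf_map_finOf_of rtW_pos allOpsM_wf allOpsM_lt)⟩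

end GProgram

/-! ### The masked blocks as embedded block circuits -/

section Blocks

variable {n : ℕ}

/-- The shifted masked block program through `foW` is the local one through the block embedding. [folklore] -/
theorem blockOpsM_map_shift (i : Fin (rtBlocks n)) :
    ((blockOpsM n (rtL n) i).map (RtOp.map (· + blkBase n i))).map (RtOp.map (foW n)) =
      ((blockOpsM n (rtL n) i).map (RtOp.map (foB n (rtL n)))).map (RtOp.map (blkEmb n i)) := by
  rw [List.map_map, List.map_map]
  refine List.map_congr_left fun op hop => ?_
  simp only [Function.comp_apply, RtOp.map_map]
  refine RtOp.map_congr fun w hw => Fin.ext ?_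
  have hwB : w < rtB n := blockOpsM_lt (le_of_lt i.isLt) op hop w hw
  simp only [Function.comp_apply, foW, val_blkEmb, foB, val_finOf_of_lt _ hwB,
    val_finOf_of_lt _ (show w + blkBase n i < rtW n by rw [add_comm]; exact blkBase_add_lt i.isLt hwB)]
  ring

/-- **The compiled masked blocks segment is the concatenation of the embedded masked block circuits.** [folklore] -/
theorem compileList_blocksOpsM (h : ∀ op ∈ (blocksOpsM n).map (RtOp.map (foW n)), op.WF) :
    RtOp.compileList ((blocksOpsM n).map (RtOp.map (foW n))) h =
      (List.finRange (rtBlocks n)).flatMap fun i => (mapWires (blkEmb n i) (QlocM n (rtL n) i)).gates := by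
  have hsplit : (blocksOpsM n).map (RtOp.map (foW n)) = (List.finRange (rtBlocks n)).flatMap fun i : Fin (rtBlocks n) =>
      ((blockOpsM n (rtL n) i.val).map (RtOp.map (foB n (rtL n)))).map (RtOp.map (blkEmb n i)) := by
    rw [blocksOpsM, List.map_flatMap, range_eq_map_finRange, List.flatMap_map]
    congr 1
    funext i
    exact blockOpsM_map_shift i
  rw [RtOp.compileList_congr hsplit h (fun op hop => h op (hsplit ▸ hop))]
  suffices key : ∀ (l : List (Fin (rtBlocks n))) (hl : ∀ op ∈ l.flatMap (fun i : Fin (rtBlocks n) =>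
      ((blockOpsM n (rtL n) i.val).map (RtOp.map (foB n (rtL n)))).map (RtOp.map (blkEmb n i))), op.WF),
      RtOp.compileList _ hl = l.flatMap fun i => (mapWires (blkEmb n i) (QlocM n (rtL n) i)).gates from key _ _
  intro l hl
  induction l with
  | nil => rfl
  | cons i l ih =>
    conv_rhs => rw [List.flatMap_cons]
    rw [RtOp.compileList_congr List.flatMap_cons hl (fun op hop => hl op (by rw [List.flatMap_cons]; exact hop)),
      RtOp.compileList_append, ih]
    congr 1
    rw [← RtOp.compileList_map_embed (blkEmb n i) ((blockOpsM n (rtL n) i).map (RtOp.map (foB n (rtL n))))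
      (wf_map_finOf_of (Bsz_pos _ _) (blockOpsM_wf (n := n) (L := rtL n) i) (blockOpsM_lt (le_of_lt i.isLt)))]
    rfl

end Blocks

/-! ### The acceptance probability of the masked big circuit -/

section Accept

variable {n : ℕ} (A : Language Bool)

/-- The masked block states. [cite: RazTalJACM2022, App. A] -/
def blockStateM (i : Fin (rtBlocks n)) : QReg (rtB n) → ℂ := (QlocM n (rtL n) i).toMatrix A *ᵥ basisState fun _ => false

/-- **The state after the masked blocks** is the product state of the masked block states over `zPre`.
[cite: NielsenChuang2010, §2.1.7 eq. (2.45)] -/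
theorem blocksM_mulVec (x : QReg n) (h : ∀ op ∈ (blocksOpsM n).map (RtOp.map (foW n)), op.WF) :
    (⟨RtOp.compileList ((blocksOpsM n).map (RtOp.map (foW n))) h⟩ : QCircuit cliffordT (rtW n)).toMatrix A *ᵥ
      basisState (zPre x) = prodState (blkEmb n) (blockStateM A) (zPre x) := by
  have hz : ∀ i : Fin (rtBlocks n), zPre x ∘ blkEmb n i = fun _ => false := by
    intro i; funext p
    simp only [Function.comp_apply]
    refine zPre_of_le x _ (by simp; have := le_blkBase (n := n) i; omega) fun h' => ?_
    have := uW_lt_blkBase (n := n) (Nat.zero_le _) (Nat.zero_le _) i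
    simp at h'; omega
  rw [compileList_blocksOpsM, basisState_eq_prodState (blkEmb n) (zPre x)]
  simp only [hz]
  exact toMatrix_flatMap_mapWires_mulVec_prodState A blockDisjoint_blkEmb (QlocM n (rtL n)) _ _

/-- The block of the masked window read by masked block `i` is block `i` of `mWindow`. [cite: AaronsonWigderson2008, Thm. 5.11 (v)] -/
theorem blockWindow_xorLang_eq_mWindow (i : Fin (rtBlocks n)) :
    blockWindow (xorLang A) n (rtL n) i = mWindow A n i := by
  funext k
  exact blockWindow_xorLang A i k

/-- The Born weight of half selector `b` in masked block `i`. [cite: RazTalJACM2022, §6] -/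
theorem blockStateM_weight (i : Fin (rtBlocks n)) (b : Bool) :
    (∑ v : QReg (rtB n), if v (fh n (rtL n)) = b then ‖blockStateM A i v‖ ^ 2 else 0) =
      if b then 1 - blockAcc n (mWindow A n i) else blockAcc n (mWindow A n i) := by
  rw [blockStateM, sum_ite_normSq_QlocM, blockWindow_xorLang_eq_mWindow]

/-- **The acceptance probability of the masked big circuit is `q1Accept` of the masked window.**
[cite: RazTalJACM2022, App. A and Claim 8.1] [cite: AaronsonWigderson2008, Thm. 5.11 (v)] -/
theorem acceptProb_bigCircM (x : QReg n) : (bigCircM n).acceptProb A x = q1Accept n (mWindow A n) := by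
  classical
  have hsplit : (allOpsM n).map (RtOp.map (foW n)) =
      ((preOps n).map (ClOp.map (foW n))).map RtOp.cl ++ ((blocksOpsM n).map (RtOp.map (foW n)) ++
        ((postOps n).map (ClOp.map (foW n))).map RtOp.cl) := by
    simp [allOpsM, List.map_map, Function.comp_def, RtOp.map]
  unfold QCircuit.acceptProb
  simp only [rtW_pos, dif_pos, QCircuit.runOn]
  unfold bigCircM
  rw [RtOp.compileList_congr hsplit _ (fun op hop => (wf_map_finOf_of rtW_pos allOpsM_wf allOpsM_lt) op (hsplit ▸ hop)),
    RtOp.compileList_append, RtOp.compileList_append, toMatrix_mk_append, toMatrix_mk_append, Matrix.mul_assoc,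
    ← Matrix.mulVec_mulVec, ← Matrix.mulVec_mulVec, pre_mulVec, blocksM_mulVec]
  rw [sum_ite_normSq_mulVec_of_perm ⟨_, post_injective⟩ (post_mulVec_basisState A _) _ (fun y => y ⟨0, rtW_pos⟩ = true)]
  simp only [Function.Embedding.coeFn_mk]
  set Ψ := prodState (blkEmb n) (blockStateM A) (zPre x) with hΨ
  set g : (Fin (rtBlocks n) → QReg (rtB n)) → ℝ := fun y =>
    if rtThreshold n ≤ (Finset.univ.filter fun i => y i (fh n (rtL n)) = false).card then 1 else 0 with hg
  have hsupp : ∀ z, (if clEval ((postOps n).map (ClOp.map (foW n))) z ⟨0, rtW_pos⟩ = true then ‖Ψ z‖ ^ 2 else 0) =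
      ‖Ψ z‖ ^ 2 * g (fun i => z ∘ blkEmb n i) := by
    intro z
    by_cases hz : ∀ w, OffBlocks (blkEmb n) w → z w = zPre x w
    · rw [post_zero x z hz, hg]
      simp only [Function.comp_apply, decide_eq_true_eq]
      split <;> simp
    · have h0 : Ψ z = 0 := by rw [hΨ, prodState_apply, if_neg hz, zero_mul]
      simp [h0]
  simp_rw [hsupp]
  rw [sum_normSq_prodState_mul blockDisjoint_blkEmb]
  have hreg : ∀ y : Fin (rtBlocks n) → QReg (rtB n), (∏ i, ‖blockStateM A i (y i)‖ ^ 2) * g y =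
      ∑ b : Fin (rtBlocks n) → Bool, (if rtThreshold n ≤ (Finset.univ.filter fun i => b i = false).card then (1 : ℝ) else 0) *
        ∏ i, (if y i (fh n (rtL n)) = b i then ‖blockStateM A i (y i)‖ ^ 2 else 0) := by
    intro y
    rw [Finset.sum_eq_single (fun i => y i (fh n (rtL n)))]
    · rw [hg, mul_comm]
      simp
    · intro b _ hb
      rw [Finset.prod_ite_zero, if_neg (fun h : ∀ i ∈ Finset.univ, y i (fh n (rtL n)) = b i =>
        hb (funext fun i => (h i (Finset.mem_univ i)).symm)), mul_zero]
    · intro h; exact absurd (Finset.mem_univ _) h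
  simp_rw [hreg]
  rw [Finset.sum_comm]
  simp_rw [← Finset.mul_sum]
  have hprod : ∀ b : Fin (rtBlocks n) → Bool,
      (∑ y : Fin (rtBlocks n) → QReg (rtB n), ∏ i, (if y i (fh n (rtL n)) = b i then ‖blockStateM A i (y i)‖ ^ 2 else 0)) =
        ∏ i, (if b i then 1 - blockAcc n (mWindow A n i) else blockAcc n (mWindow A n i)) := by
    intro b
    have := Finset.prod_univ_sum (fun _ : Fin (rtBlocks n) => (Finset.univ : Finset (QReg (rtB n))))
      (fun i v => if v (fh n (rtL n)) = b i then ‖blockStateM A i v‖ ^ 2 else 0)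
    rw [Fintype.piFinset_univ] at this
    rw [← this]
    exact Finset.prod_congr rfl fun i _ => blockStateM_weight A i (b i)
  simp_rw [hprod]
  unfold q1Accept runPattern
  rw [← Fintype.sum_equiv (patternEquiv (rtBlocks n)) _ _ (fun b => rfl)]
  refine Finset.sum_congr rfl fun b _ => ?_
  simp only [patternEquiv, Equiv.coe_fn_mk, Finset.mem_filter, Finset.mem_univ, true_and]
  split
  · rw [one_mul]
    refine Finset.prod_congr rfl fun i _ => ?_
    cases b i <;> simp
  · rw [zero_mul]

end Accept

/-! ### The family -/

section Family

variable (n : ℕ)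

/-- **The masked Raz–Tal family** with threshold `n₀` and table `tbl`. [cite: RazTalJACM2022, App. A] -/
def rtFamilyM (n₀ : ℕ) (tbl : ℕ → Bool) : QCircuitFamily cliffordT :=
  ⟨rtAnc, fun n => if n < n₀ then smallCirc n (tbl n) else bigCircM n⟩

variable {n}

/-- Below `n₀` the masked family accepts with probability `tbl |x|`. [cite: RazTalJACM2022, App. A] -/
theorem acceptProbOn_rtFamilyM_of_lt (n₀ : ℕ) (tbl : ℕ → Bool) (A : Language Bool) (x : List Bool) (hx : x.length < n₀) :
    (rtFamilyM n₀ tbl).acceptProbOn A x = if tbl x.length then 1 else 0 := by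
  unfold QCircuitFamily.acceptProbOn rtFamilyM
  simp only [hx, ↓reduceIte]
  exact acceptProb_smallCirc A (tbl x.length) x.get

/-- From `n₀` on the masked family accepts with probability `q1Accept |x|` of the masked window.
[cite: RazTalJACM2022, App. A and Claim 8.1] -/
theorem acceptProbOn_rtFamilyM_of_le (n₀ : ℕ) (tbl : ℕ → Bool) (A : Language Bool) (x : List Bool) (hx : n₀ ≤ x.length) :
    (rtFamilyM n₀ tbl).acceptProbOn A x = q1Accept x.length (mWindow A x.length) := by
  unfold QCircuitFamily.acceptProbOn rtFamilyM
  simp only [not_lt.2 hx, ↓reduceIte]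
  exact acceptProb_bigCircM A x.get

/-- **The quantum side of the algebraic oracle separation, from the uniformity of the masked
family**: for every threshold `n₀` and table `tbl` there is a uniform `BQP^O` family accepting with
probability `tbl |x|` below `n₀` and `q1Accept |x| (mWindow O |x|)` from `n₀` on.
[cite: RazTalJACM2022, App. A] [cite: AaronsonWigderson2008, Thm. 5.11 (v)] -/
theorem maskedMachine_of_isUniform (hU : ∀ (n₀ : ℕ) (tbl : ℕ → Bool), (rtFamilyM n₀ tbl).IsUniform)
    (n₀ : ℕ) (tbl : ℕ → Bool) :
    ∃ F : QCircuitFamily cliffordT, F.IsUniform ∧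
      ∀ (A : Language Bool) (x : List Bool),
        (x.length < n₀ → F.acceptProbOn A x = if tbl x.length then 1 else 0) ∧
        (n₀ ≤ x.length → F.acceptProbOn A x = q1Accept x.length (mWindow A x.length)) :=
  ⟨rtFamilyM n₀ tbl, hU n₀ tbl, fun A x =>
    ⟨fun hx => acceptProbOn_rtFamilyM_of_lt n₀ tbl A x hx, fun hx => acceptProbOn_rtFamilyM_of_le n₀ tbl A x hx⟩⟩

end Family

end RazTalMachine

end Literature.Computability.QuantumComplexity

end
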